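import Summits.Ventures.PercRepro2.CaseOneStarPolyQtI

/-!
# The marked star, `(i)`-side Q-threshold form: the `(r, s)`-Bernstein form of the coefficient `cfQtI02`
(blind cell PercRepro2, p1 g16; S5 §2.1 (K9) (q))

`cfQtI02` (the coefficient of `q₁^0 q₂^2` in `EredQtI`, an expression in the parts) is a polynomial of
degree `(3, 3)` in `(r, s)`; its Bernstein coefficients `cBQtI_02kl` (times `9`; explicit cubics in the ten
cells) and the identity `cfQtI02_bern` (a `ring` identity after unfolding the parts). The block coefficients
`eBQtI_ijkl` of `CaseOneStarBlockQtI*.lean` are integer combinations of these. -/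

namespace Summit.Ventures.PercRepro2

namespace CaseOne

section CfQtI02
variable {R : Type*} [CommRing R]

set_option maxHeartbeats 0 in
/-- `9 ×` the `(1,2)` Bernstein coefficient in `(r, s)` of `cfQtI02`. -/
def cBQtI0212 (m : SCells R) : R :=
  (-1 : R) * m.c4 * m.c5 * m.c7 + (-1 : R) * m.c4 * m.c3 * m.c7 + (-1 : R) * m.c5 * m.c7 * m.c1 + (-1 : R) * m.c5 * m.c7 ^ 2 + (-1 : R) * m.c3 * m.c7 * m.c1 + (-1 : R) * m.c3 * m.c7 ^ 2

set_option maxHeartbeats 0 in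
/-- `9 ×` the `(2,1)` Bernstein coefficient in `(r, s)` of `cfQtI02`. -/
def cBQtI0221 (m : SCells R) : R :=
  (-1 : R) * m.c4 * m.c5 * m.c7 + (-1 : R) * m.c4 * m.c3 * m.c7 + (-2 : R) * m.c5 * m.c3 * m.c7 + (-1 : R) * m.c5 ^ 2 * m.c7 + (-1 : R) * m.c3 ^ 2 * m.c7

set_option maxHeartbeats 0 in
/-- `9 ×` the `(2,2)` Bernstein coefficient in `(r, s)` of `cfQtI02`. -/
def cBQtI0222 (m : SCells R) : R :=
  (-1 : R) * m.c4 * m.c5 * m.c7 + (-1 : R) * m.c4 * m.c3 * m.c7 + (-1 : R) * m.c5 * m.c3 * m.c7 + (-1 : R) * m.c5 * m.c7 * m.c1 + (-1 : R) * m.c3 * m.c7 * m.c1 + (-1 : R) * m.c3 ^ 2 * m.c7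

set_option maxHeartbeats 0 in
/-- **The `(r, s)`-Bernstein form of `cfQtI02`**: `9 · cfQtI02 = Σ C(3,k) C(3,l) rᵏ(1−r)³⁻ᵏ sˡ(1−s)³⁻ˡ · cBQtI_02kl`. -/
theorem cfQtI02_bern (r s : R) (m : SCells R) :
    9 * cfQtI02 r s m = (9 : R) * r ^ 1 * (1 - r) ^ 2 * s ^ 2 * (1 - s) ^ 1 * cBQtI0212 m + (9 : R) * r ^ 2 * (1 - r) ^ 1 * s ^ 1 * (1 - s) ^ 2 * cBQtI0221 m + (9 : R) * r ^ 2 * (1 - r) ^ 1 * s ^ 2 * (1 - s) ^ 1 * cBQtI0222 m := by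
  unfold cfQtI02 ptQ01 ptQA00 ptQAB100 ptQAB1O00 ptQAO00 ptQB101 ptYU01 cBQtI0212 cBQtI0221 cBQtI0222
  ring

end CfQtI02

end CaseOne

end Summit.Ventures.PercRepro2
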